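import Literature.Computability.Complexity.ExpTimeCollapsesProofs
import Literature.Computability.Complexity.CountingHierarchyPH
import Literature.Computability.Complexity.CountingHierarchyPSPACE
import Literature.Computability.Complexity.BPClosureProofs
import Literature.Computability.Complexity.SipserGacsLautemann
import Literature.Computability.Complexity.KannanLanguageAE
import HarnessLib

/-!
# IW98, Case 2, endgame: under `EXP ⊆ P/poly` and `BPP ≠ EXP` no `PSPACE`-hard language is in `BPP`
# (Trevisan–Vadhan 2007, proof of Thm. 3.9 with §4; Impagliazzo–Wigderson 1998, §2.1)

Literature / complexity — derandomization. The class-level contradiction closing Case 2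
(`EXP ⊆ P/poly`) of the printed proof of `impagliazzoWigderson1998` (van Melkebeek 2000, Thm. 6.2.1 =
Impagliazzo–Wigderson 1998, Thm. 5), in the PSPACE form of Trevisan–Vadhan 2007 (Thm. 4.3: a
`PSPACE`-complete problem that is both self-correctible and downward self-reducible replaces IW's
`ModPerm`, "eliminating the use of Valiant's Theorem and Toda's Theorem"): once the reconstruction and
the bootstrapping put that complete function in `BPP`, the whole of `EXP` falls into `BPP`, against
`BPP ≠ EXP`. In the tree's classes:

* `SigmaP_two_subset_PSPACE` — `Σ₂ᵖ ⊆ PH ⊆ CH ⊆ PSPACE`;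
* `BPP_subset_EXP` — `BPP ⊆ Σ₂ᵖ ⊆ PH ⊆ EXP` (Sipser–Gács–Lautemann in the tree);
* `EXP_subset_PSPACE_of_subset_PPoly`, `EXP_eq_PSPACE_of_subset_PPoly` — Meyer's theorem
  (`EXP ⊆ P/poly ⟹ EXP = Σ₂ᵖ`, `EXP_eq_SigmaP_two_of_subset_PPoly_holds`) collapses `EXP` to `PSPACE`;
* **`EXP_subset_BPP_of_isHard_PSPACE`** — `EXP ⊆ P/poly ⟹ (L PSPACE-hard, L ∈ BPP) ⟹ EXP ⊆ BPP`
  (`BPP` is closed under Karp reductions, `mem_BPP_of_karpReducible`);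
* **`not_mem_BPP_of_isHard_PSPACE`** — hence under `EXP ⊆ P/poly` and `BPP ≠ EXP` every
  `PSPACE`-hard language lies outside `BPP` (TV07, proof of Thm. 3.9: "Since `f₁` is EXP-complete, we
  deduce that `f ∈ BPTIME(…)`, contradicting the hypothesis"; IW98 §2.1: "we can assume that computing
  the permanent is not possible in `BPP`", here for `PSPACE`-hard problems).

Everything is proved; no definitions, no named facts.

## References

* [TrevisanVadhan2007] L. Trevisan, S. Vadhan, *Pseudorandomness and average-case complexity via
  uniform reductions*, Comput. Complexity 16 (2007) 331–364, Lemma 3.7 (Meyer), Lemma 3.8, Thm. 3.9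
  (proof), §4 and Thm. 4.3 (held text, pp. 10, 12–13).
* [ImpagliazzoWigderson2001] R. Impagliazzo, A. Wigderson, JCSS 63 (2001), §2.1 (second and third
  paragraphs: `EXP ⊆ P/poly ⟹ EXP = Σ₂`, "we can assume that computing the permanent is not possible
  in `BPP`").
* [AroraBarakCC2009] S. Arora, B. Barak, CUP 2009, §5.2 (`PH ⊆ PSPACE`), Thm. 7.15 (`BPP ⊆ Σ₂ᵖ`),
  §7.6 (closure of `BPP` under reductions).
-/

namespace Literature.Computability.Complexity

/-- `Σ₂ᵖ ⊆ PSPACE` (`Σ₂ᵖ ⊆ PH ⊆ CH ⊆ PSPACE` in the tree). [cite: AroraBarakCC2009, §5.2] -/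
theorem SigmaP_two_subset_PSPACE : SigmaP 2 ⊆ PSPACE :=
  (SigmaP_subset_PH 2).trans (PH_subset_CH_holds.trans CH_subset_PSPACE_holds)

/-- `BPP ⊆ EXP` (`BPP ⊆ Σ₂ᵖ ⊆ PH ⊆ EXP` in the tree). [cite: AroraBarakCC2009, §7.1 (remark after Def. 7.3) and Thm. 7.15] -/
theorem BPP_subset_EXP : BPP ⊆ EXP :=
  BPP_subset_SigmaP_two.trans ((SigmaP_subset_PH 2).trans PH_subset_EXP)

/-- **Meyer's collapse reaches `PSPACE`**: `EXP ⊆ P/poly ⟹ EXP ⊆ PSPACE` (`EXP = Σ₂ᵖ ⊆ PSPACE`).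
[cite: TrevisanVadhan2007, Lemma 3.7] [cite: ImpagliazzoWigderson2001, §2.1] -/
theorem EXP_subset_PSPACE_of_subset_PPoly (h : EXP ⊆ PPoly) : EXP ⊆ PSPACE := by
  rw [EXP_eq_SigmaP_two_of_subset_PPoly_holds h]
  exact SigmaP_two_subset_PSPACE

/-- `EXP ⊆ P/poly ⟹ EXP = PSPACE`. [cite: TrevisanVadhan2007, Lemma 3.7] -/
theorem EXP_eq_PSPACE_of_subset_PPoly (h : EXP ⊆ PPoly) : EXP = PSPACE :=
  (EXP_subset_PSPACE_of_subset_PPoly h).antisymm PSPACE_subset_EXP_holds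

/-- **A `PSPACE`-hard language in `BPP` drags `EXP` into `BPP` under `EXP ⊆ P/poly`**: every
`A ∈ EXP = PSPACE` Karp-reduces to `L ∈ BPP`, and `BPP` is closed under Karp reductions.
[cite: TrevisanVadhan2007, Thm. 3.9 (proof)] [cite: AroraBarakCC2009, §7.6] -/
theorem EXP_subset_BPP_of_isHard_PSPACE (h : EXP ⊆ PPoly) {L : Language Bool} (hL : IsHard PSPACE L)
    (hB : L ∈ BPP) : EXP ⊆ BPP :=
  fun A hA => mem_BPP_of_karpReducible (hL A (EXP_subset_PSPACE_of_subset_PPoly h hA)) hB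

/-- **The endgame of Case 2**: under `EXP ⊆ P/poly` and `BPP ≠ EXP`, no `PSPACE`-hard language is in
`BPP` — the contradiction that the reconstruction (IW Lemmas 13–16 / TV07 Lemmas 3.5–3.6) is played
against. [cite: TrevisanVadhan2007, Thm. 3.9 (proof) and Thm. 4.3] [cite: ImpagliazzoWigderson2001, §2.1 and Lemma 17] -/
theorem not_mem_BPP_of_isHard_PSPACE (h : EXP ⊆ PPoly) (hne : BPP ≠ EXP) {L : Language Bool}
    (hL : IsHard PSPACE L) : L ∉ BPP :=
  fun hB => hne (BPP_subset_EXP.antisymm (EXP_subset_BPP_of_isHard_PSPACE h hL hB))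

end Literature.Computability.Complexity
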